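import Summits.CriticalPhenomena.PercolationContinuityZ3.Theorems.PercNearOneGluingNoHeavyLowerTailSahiCTCRtThreeDoubledSlice
import Summits.CriticalPhenomena.PercolationContinuityZ3.Theorems.PercNearOneGluingNoHeavyLowerTailSahiCTCRtThreeSignedForm
import Summits.CriticalPhenomena.PercolationContinuityZ3.Theorems.PercNearOneGluingNoHeavyLowerTailSahiCTCRtThreeBilinear
import HarnessLib

/-!
# `NoHeavyLowerTail` (crux stmt-CriticalPhenomena-4575), P3 lane: the row with ONE DOUBLED POINT in BLOCK FORM —
# three Harris–Kleitman blocks of the deletions/links, the pivot term, and window terms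

Support file (seat `prim-l12-p3`, gen 51; `--supports stmt-CriticalPhenomena-4575`).  Memo
`run/shared/lean/prim/prim-l12/FROM-prim-l12-p3-g51-ROW0-ALL-K-LEAN.md` §5 (block form validated numerically against the definition of `R_3`).

From `…RtThreeDoubledSlice.coeff_Rt_three_add_single_two_eq`: at the profile `1_σ + 2e_d` (`d ∉ σ`) the primed (deleted) fixed families may be
replaced by the unprimed ones (`coeff_Rt_three_ind_add_single_two`), and regrouping the nine products gives
`coeff_ind_add_single_two_Rt_three_eq_blocks`:
  `B_1 = Σ_{U⊆σ,#U≤2} κ_{X¹,Z¹}(σ∖U) + Σ_{#U≤1} [κ_{X⁰,Z¹}(σ∖U) + κ_{X¹,Z⁰}(σ∖U)] + [s^σ] Θ₁·Π·IE − [s^σ] Θ₂·Π·(Y¹¹)_{<2} − [s^σ] Θ₁·Π·((Y⁰⁰)_{<3} + (Y¹¹)_{<2})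
        + Σ_{S⊆σ} (pairsAt X¹_{<2} Z⁰_{<3} + pairsAt X⁰_{<3} Z¹_{<2} + pairsAt X¹_{<2} Z¹_{<2})(σ∖S)`,
with `X⁰ = delV d 𝒳`, `X¹ = linkV d 𝒳`, `Y⁰⁰ = X⁰ ∩ Z⁰`, `Y¹¹ = X¹ ∩ Z¹`, `κ = kap · · ∅` (`…KleitmanSurplus`), and the inclusion–exclusion polynomial
`IE = GF(X⁰∩Z⁰) + GF(X¹∩Z¹) − GF(X⁰∩Z¹) − GF(X¹∩Z⁰)`, which for up-sets (`X⁰ ⊆ X¹`, `Z⁰ ⊆ Z¹`) is `GF(M)`, `M = (X¹∩Z¹) ∖ (X⁰ ∪ Z⁰)` (`gf_ie_eq_gf_pivot`):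
the pivot-`d` atoms.  The first sum is the shape of `…KleitmanBulk.sum_kap_eq_atomSum` (Kleitman bulk on `σ`); `coeff_ind_ThetaOne_harris_eq_sum_kap` is the
`Θ₁` companion of `…SignedForm.coeff_ind_Theta_harris_eq_sum_kap`.  No new definitions; nothing is asserted about the crux.
-/

noncomputable section

open scoped Classical

namespace Summit.CriticalPhenomena.PercolationContinuityZ3.Theorems.SahiCTCForms

open Finset MvPolynomial SahiCTCGenFun

variable {α : Type*} [DecidableEq α] [Fintype α]

omit [Fintype α] in
/-- A family all of whose members avoid `d` is its own deletion. [this work] -/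
theorem delV_eq_self_of_forall {d : α} {K : Finset (Finset α)} (h : ∀ S ∈ K, d ∉ S) : delV d K = K := by
  unfold delV; exact filter_true_of_mem h

omit [Fintype α] in
/-- At a `d`-free profile, deleting `d` from the first two factors of a triple product with a `d`-free third factor changes nothing. [this work] -/
theorem coeff_gf3_delV_delV {d : α} (A B K : Finset (Finset α)) (hK : ∀ S ∈ K, d ∉ S) {n : α →₀ ℕ} (hn : n d = 0) :
    (gf (delV d A) * gf (delV d B) * gf K).coeff n = (gf A * gf B * gf K).coeff n := by
  rw [coeff_gf3_wfree A B K d hn, delV_eq_self_of_forall hK]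

omit [Fintype α] in
/-- At a `d`-free profile, deleting `d` from the first factor of a triple product with `d`-free other factors changes nothing. [this work] -/
theorem coeff_gf3_delV {d : α} (A K L : Finset (Finset α)) (hK : ∀ S ∈ K, d ∉ S) (hL : ∀ S ∈ L, d ∉ S) {n : α →₀ ℕ} (hn : n d = 0) :
    (gf (delV d A) * gf K * gf L).coeff n = (gf A * gf K * gf L).coeff n := by
  rw [coeff_gf3_wfree A K L d hn, delV_eq_self_of_forall hK, delV_eq_self_of_forall hL]

/-- **The row with one doubled point at `1_σ + 2e_d` (`d ∉ σ`) with UNPRIMED fixed families**: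
`Θ₁ΠY⁰⁰_{≥3} + Θ₁ΠY¹¹_{≥2} + Θ₂ΠY¹¹_{≥2} − Θ₁X¹Z⁰ − Θ₁X⁰Z¹ − Θ₂X¹Z¹ + Π(X¹_{<2}Z⁰_{<3} + X⁰_{<3}Z¹_{<2} + X¹_{<2}Z¹_{<2})`. [this work] -/
theorem coeff_Rt_three_ind_add_single_two (F G : Finset (Finset α)) {σ : Finset α} {d : α} (hd : d ∉ σ) :
    (Rt 3 F G).coeff (ind σ + Finsupp.single d 2) =
      (gf (bySize (· < 2) : Finset (Finset α)) * gf (univ.powerset : Finset (Finset α)) * gf (atLeast 3 (delV d F ∩ delV d G))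
        + gf (bySize (· < 2) : Finset (Finset α)) * gf (univ.powerset : Finset (Finset α)) * gf (atLeast 2 (linkV d F ∩ linkV d G))
        + gf (bySize (· < 3) : Finset (Finset α)) * gf (univ.powerset : Finset (Finset α)) * gf (atLeast 2 (linkV d F ∩ linkV d G))
      - (gf (bySize (· < 2) : Finset (Finset α)) * gf (linkV d F) * gf (delV d G)
        + gf (bySize (· < 2) : Finset (Finset α)) * gf (delV d F) * gf (linkV d G)
        + gf (bySize (· < 3) : Finset (Finset α)) * gf (linkV d F) * gf (linkV d G))
      + (gf (univ.powerset : Finset (Finset α)) * gf (below 2 (linkV d F)) * gf (below 3 (delV d G))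
        + gf (univ.powerset : Finset (Finset α)) * gf (below 3 (delV d F)) * gf (below 2 (linkV d G))
        + gf (univ.powerset : Finset (Finset α)) * gf (below 2 (linkV d F)) * gf (below 2 (linkV d G)))).coeff (ind σ) := by
  have hn : (ind σ) d = 0 := by rw [ind_apply, if_neg hd]
  have hX0 : ∀ S ∈ delV d F, d ∉ S := fun S h => not_mem_of_mem_delV h
  have hX1 : ∀ S ∈ linkV d F, d ∉ S := fun S h => not_mem_of_mem_linkV h
  have hZ0 : ∀ S ∈ delV d G, d ∉ S := fun S h => not_mem_of_mem_delV h
  have hZ1 : ∀ S ∈ linkV d G, d ∉ S := fun S h => not_mem_of_mem_linkV h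
  have hAt : ∀ (t : ℕ) (A B : Finset (Finset α)), (∀ S ∈ A, d ∉ S) → ∀ S ∈ atLeast t (A ∩ B), d ∉ S :=
    fun t A B hA S h => hA S (mem_inter.1 (mem_filter.1 h).1).1
  have hBe : ∀ (t : ℕ) (A : Finset (Finset α)), (∀ S ∈ A, d ∉ S) → ∀ S ∈ below t A, d ∉ S :=
    fun t A hA S h => hA S (mem_filter.1 h).1
  rw [coeff_Rt_three_add_single_two_eq F G d hn]
  simp only [coeff_add, coeff_sub]
  rw [coeff_gf3_delV_delV _ _ _ (hAt 3 _ _ hX0) hn, coeff_gf3_delV_delV _ _ _ (hAt 2 _ _ hX1) hn, coeff_gf3_delV_delV _ _ _ (hAt 2 _ _ hX1) hn,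
    coeff_gf3_delV _ _ _ hX1 hZ0 hn, coeff_gf3_delV _ _ _ hX0 hZ1 hn, coeff_gf3_delV _ _ _ hX1 hZ1 hn,
    coeff_gf3_delV _ _ _ (hBe 2 _ hX1) (hBe 3 _ hZ0) hn, coeff_gf3_delV _ _ _ (hBe 3 _ hX0) (hBe 2 _ hZ1) hn,
    coeff_gf3_delV _ _ _ (hBe 2 _ hX1) (hBe 2 _ hZ1) hn]

/-- **`[s^V] Θ₁·(Π·GF(A∩B) − GF(A)·GF(B)) = Σ_{U ⊆ V, #U ≤ 1} κ_{A,B}(V∖U)`** — the `Θ₁` companion of `coeff_ind_Theta_harris_eq_sum_kap`. [this work] -/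
theorem coeff_ind_ThetaOne_harris_eq_sum_kap (A B : Finset (Finset α)) (V : Finset α) :
    (gf (bySize (· < 2) : Finset (Finset α)) * (PiP * gf (A ∩ B) - gf A * gf B)).coeff (ind V) =
      ∑ U ∈ V.powerset.filter (fun U => #U ≤ 1), kap A B ∅ (V \ U) := by
  rw [coeff_gf_mul]
  have hidx : ((bySize (· < 2) : Finset (Finset α)).filter fun U => ind U ≤ ind V) = V.powerset.filter fun U => #U ≤ 1 := by
    ext U
    simp only [bySize, mem_filter, mem_powerset, subset_univ, true_and, ind_le_ind_iff]
    constructor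
    · rintro ⟨h1, h2⟩; exact ⟨h2, by omega⟩
    · rintro ⟨h1, h2⟩; exact ⟨by omega, h1⟩
  rw [hidx]
  refine sum_congr rfl fun U hU => ?_
  rw [ind_sub_ind (mem_powerset.1 (mem_filter.1 hU).1), coeff_ind_harris_eq_kap]

/-- **THE ROW WITH ONE DOUBLED POINT IN BLOCK FORM** (all families; `d ∉ σ`):
`B_1 = Σ_{#U≤2} κ_{X¹Z¹}(σ∖U) + Σ_{#U≤1}[κ_{X⁰Z¹} + κ_{X¹Z⁰}](σ∖U) + [s^σ]Θ₁·Π·IE − [s^σ]Θ₂·(Π·Y¹¹_{<2}) − [s^σ]Θ₁·(Π·(Y⁰⁰_{<3} + Y¹¹_{<2})) + (crossing small products)`. [this work] -/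
theorem coeff_ind_add_single_two_Rt_three_eq_blocks (F G : Finset (Finset α)) {σ : Finset α} {d : α} (hd : d ∉ σ) :
    (Rt 3 F G).coeff (ind σ + Finsupp.single d 2) =
      (∑ U ∈ σ.powerset.filter (fun U => #U ≤ 2), kap (linkV d F) (linkV d G) ∅ (σ \ U))
      + (∑ U ∈ σ.powerset.filter (fun U => #U ≤ 1), kap (delV d F) (linkV d G) ∅ (σ \ U))
      + (∑ U ∈ σ.powerset.filter (fun U => #U ≤ 1), kap (linkV d F) (delV d G) ∅ (σ \ U))
      + (gf (bySize (· < 2) : Finset (Finset α)) * (PiP *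
          (gf (delV d F ∩ delV d G) + gf (linkV d F ∩ linkV d G) - gf (delV d F ∩ linkV d G) - gf (linkV d F ∩ delV d G)))).coeff (ind σ)
      - (gf (bySize (· < 3) : Finset (Finset α)) * (PiP * gf (below 2 (linkV d F ∩ linkV d G)))).coeff (ind σ)
      - (gf (bySize (· < 2) : Finset (Finset α)) * (PiP * (gf (below 3 (delV d F ∩ delV d G)) + gf (below 2 (linkV d F ∩ linkV d G))))).coeff (ind σ)
      + (∑ S ∈ σ.powerset, (pairsAt (below 2 (linkV d F)) (below 3 (delV d G)) (σ \ S) : ℤ))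
      + (∑ S ∈ σ.powerset, (pairsAt (below 3 (delV d F)) (below 2 (linkV d G)) (σ \ S) : ℤ))
      + (∑ S ∈ σ.powerset, (pairsAt (below 2 (linkV d F)) (below 2 (linkV d G)) (σ \ S) : ℤ)) := by
  have e1 : gf (atLeast 3 (delV d F ∩ delV d G)) = gf (delV d F ∩ delV d G) - gf (below 3 (delV d F ∩ delV d G)) := by
    rw [gf_eq_atLeast_add_below 3 (delV d F ∩ delV d G)]; ring
  have e2 : gf (atLeast 2 (linkV d F ∩ linkV d G)) = gf (linkV d F ∩ linkV d G) - gf (below 2 (linkV d F ∩ linkV d G)) := by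
    rw [gf_eq_atLeast_add_below 2 (linkV d F ∩ linkV d G)]; ring
  have hpoly :
      gf (bySize (· < 2) : Finset (Finset α)) * gf (univ.powerset : Finset (Finset α)) * gf (atLeast 3 (delV d F ∩ delV d G))
        + gf (bySize (· < 2) : Finset (Finset α)) * gf (univ.powerset : Finset (Finset α)) * gf (atLeast 2 (linkV d F ∩ linkV d G))
        + gf (bySize (· < 3) : Finset (Finset α)) * gf (univ.powerset : Finset (Finset α)) * gf (atLeast 2 (linkV d F ∩ linkV d G))
      - (gf (bySize (· < 2) : Finset (Finset α)) * gf (linkV d F) * gf (delV d G)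
        + gf (bySize (· < 2) : Finset (Finset α)) * gf (delV d F) * gf (linkV d G)
        + gf (bySize (· < 3) : Finset (Finset α)) * gf (linkV d F) * gf (linkV d G))
      + (gf (univ.powerset : Finset (Finset α)) * gf (below 2 (linkV d F)) * gf (below 3 (delV d G))
        + gf (univ.powerset : Finset (Finset α)) * gf (below 3 (delV d F)) * gf (below 2 (linkV d G))
        + gf (univ.powerset : Finset (Finset α)) * gf (below 2 (linkV d F)) * gf (below 2 (linkV d G)))
      = gf (bySize (· < 3) : Finset (Finset α)) * (PiP * gf (linkV d F ∩ linkV d G) - gf (linkV d F) * gf (linkV d G))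
        + gf (bySize (· < 2) : Finset (Finset α)) * (PiP * gf (delV d F ∩ linkV d G) - gf (delV d F) * gf (linkV d G))
        + gf (bySize (· < 2) : Finset (Finset α)) * (PiP * gf (linkV d F ∩ delV d G) - gf (linkV d F) * gf (delV d G))
        + gf (bySize (· < 2) : Finset (Finset α)) * (PiP *
            (gf (delV d F ∩ delV d G) + gf (linkV d F ∩ linkV d G) - gf (delV d F ∩ linkV d G) - gf (linkV d F ∩ delV d G)))
        - gf (bySize (· < 3) : Finset (Finset α)) * (PiP * gf (below 2 (linkV d F ∩ linkV d G)))
        - gf (bySize (· < 2) : Finset (Finset α)) * (PiP * (gf (below 3 (delV d F ∩ delV d G)) + gf (below 2 (linkV d F ∩ linkV d G))))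
        + (PiP : MvPolynomial α ℤ) * (gf (below 2 (linkV d F)) * gf (below 3 (delV d G)))
        + (PiP : MvPolynomial α ℤ) * (gf (below 3 (delV d F)) * gf (below 2 (linkV d G)))
        + (PiP : MvPolynomial α ℤ) * (gf (below 2 (linkV d F)) * gf (below 2 (linkV d G))) := by
    rw [e1, e2]; unfold PiP; ring
  rw [coeff_Rt_three_ind_add_single_two F G hd, hpoly]
  simp only [coeff_add, coeff_sub]
  rw [coeff_ind_Theta_harris_eq_sum_kap, coeff_ind_ThetaOne_harris_eq_sum_kap, coeff_ind_ThetaOne_harris_eq_sum_kap,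
    coeff_ind_PiP_mul_gf_mul_gf, coeff_ind_PiP_mul_gf_mul_gf, coeff_ind_PiP_mul_gf_mul_gf]

omit [Fintype α] in
/-- **For up-sets the inclusion–exclusion polynomial is the pivot family**: if `X⁰ ⊆ X¹` and `Z⁰ ⊆ Z¹` then
`GF(X⁰∩Z⁰) + GF(X¹∩Z¹) − GF(X⁰∩Z¹) − GF(X¹∩Z⁰) = GF((X¹∩Z¹) ∖ (X⁰ ∪ Z⁰))`. [this work] -/
theorem gf_ie_eq_gf_pivot {X0 X1 Z0 Z1 : Finset (Finset α)} (hX : X0 ⊆ X1) (hZ : Z0 ⊆ Z1) :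
    gf (X0 ∩ Z0) + gf (X1 ∩ Z1) - gf (X0 ∩ Z1) - gf (X1 ∩ Z0) = gf ((X1 ∩ Z1) \ (X0 ∪ Z0)) := by
  -- split `X1 ∩ Z1` by membership in `X0` and `Z0`
  have h1 : gf (X1 ∩ Z1) = gf (X0 ∩ Z1) + gf ((X1 ∩ Z1).filter fun S => S ∉ X0) := by
    rw [← gf_union]
    · congr 1; ext S; simp only [mem_inter, mem_union, mem_filter]
      constructor
      · rintro ⟨h1, h2⟩; by_cases h : S ∈ X0; exacts [Or.inl ⟨h, h2⟩, Or.inr ⟨⟨h1, h2⟩, h⟩]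
      · rintro (⟨h1, h2⟩ | ⟨⟨h1, h2⟩, _⟩); exacts [⟨hX h1, h2⟩, ⟨h1, h2⟩]
    · exact disjoint_left.2 fun S h h' => (mem_filter.1 h').2 (mem_inter.1 h).1
  have h2 : gf ((X1 ∩ Z1).filter fun S => S ∉ X0) = gf ((X1 ∩ Z0).filter fun S => S ∉ X0) + gf ((X1 ∩ Z1) \ (X0 ∪ Z0)) := by
    rw [← gf_union]
    · congr 1; ext S; simp only [mem_inter, mem_union, mem_filter, mem_sdiff, not_or]
      constructor
      · rintro ⟨⟨h1, h2⟩, h3⟩; by_cases h : S ∈ Z0; exacts [Or.inl ⟨⟨h1, h⟩, h3⟩, Or.inr ⟨⟨h1, h2⟩, h3, h⟩]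
      · rintro (⟨⟨h1, h2⟩, h3⟩ | ⟨⟨h1, h2⟩, h3, _⟩); exacts [⟨⟨h1, hZ h2⟩, h3⟩, ⟨⟨h1, h2⟩, h3⟩]
    · exact disjoint_left.2 fun S h h' => (mem_sdiff.1 h').2 (mem_union_right _ (mem_inter.1 (mem_filter.1 h).1).2)
  have h3 : gf (X1 ∩ Z0) = gf (X0 ∩ Z0) + gf ((X1 ∩ Z0).filter fun S => S ∉ X0) := by
    rw [← gf_union]
    · congr 1; ext S; simp only [mem_inter, mem_union, mem_filter]
      constructor
      · rintro ⟨h1, h2⟩; by_cases h : S ∈ X0; exacts [Or.inl ⟨h, h2⟩, Or.inr ⟨⟨h1, h2⟩, h⟩]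
      · rintro (⟨h1, h2⟩ | ⟨⟨h1, h2⟩, _⟩); exacts [⟨hX h1, h2⟩, ⟨h1, h2⟩]
    · exact disjoint_left.2 fun S h h' => (mem_filter.1 h').2 (mem_inter.1 h).1
  rw [h1, h2, h3]; ring

/-- For an up-set the deletion at `d` is contained in the link at `d`. [this work] -/
theorem delV_subset_linkV {F : Finset (Finset α)} (hF : IsUpperSet (F : Set (Finset α))) (d : α) : delV d F ⊆ linkV d F :=
  delV_subset_linkV_of_isUpperSet hF

end Summit.CriticalPhenomena.PercolationContinuityZ3.Theorems.SahiCTCForms
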